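import Mathlib
import HarnessLib
import Summits.HubbardSuperconductivity.HubbardSuperconductivity.Theorems.KLProgrammeKLRegimeSectorSliceGram
import Summits.HubbardSuperconductivity.HubbardSuperconductivity.Theorems.KLProgrammeSoftLineDyadicSum

/-!
# Route `KLProgramme` — ENGINE child gen 8 (stmt-HubbardSuperconductivity-20437 `KLRegimeEngineV17F2`), skeleton v2 class #3 witness input GAP L2
# («SHARP soft-covariance sector data»; owner k3c2-p2 per plan g17 (R47i)): the ENTRY of a sectorised normal covariance bounded by the SUM of the
# symbol over ONE sector's support (not count × sup), and the dyadic form ready for the soft line (cell gate-hubbard-kl, seat hubbard-kl-k3c2-p2 g8)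

`norm_sectorSub_pullback_normalCovariance_le_of_count` (k3c2-p3, …SectorSliceGram) bounds `‖(S(F)ᵀ·normalCovariance p·S(F)) Y Y′‖` by
`‖(βL²)⁻¹‖²·(Ns·P)` — COUNT of the joint support × SUP of the symbol.  For the SOFT covariance `D_{n′}` (symbol `≍ βL²/ρ`, `ρ = √(ω²+e_K²)` down to
the temperature floor) count × sup costs `Λ_n/Λ_{n_β+1}`; the sharp law needs the SUM `Σ_{k ∈ supp F_ω} ‖p(k,σ)‖` instead, which the dyadic
lemma `sum_div_radius_le_of_dyadic_mass'` (…SoftLineDyadicSum) bounds β-uniformly from annulus counts.  This file: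

* **`norm_sectorSub_pullback_normalCovariance_le_of_sum`** — `‖F_ω‖ ≤ 1` ⟹
  `‖(S(F)ᵀ·normalCovariance p·S(F)) Y Y′‖ ≤ ‖(βL²)⁻¹‖² · Σ_{k : F_{ω_Y}(k) ≠ 0} ‖p(k, σ_Y)‖` (same closed form, termwise);
* **`norm_sectorSub_pullback_normalCovariance_le_of_dyadic`** — if moreover on the support of `F_{ω_Y}` the symbol is soft-shaped,
  `‖p(k,σ)‖ ≤ A/ρ k` with `ρmin ≤ ρ k ≤ Λ` wherever `F_{ω_Y}(k) ≠ 0`, and the sector's ANNULUS COUNTS obey `#{k : F_{ω_Y}(k) ≠ 0, r/2 < ρ k ≤ r} ≤ C·r²`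
  for `0 < r ≤ Λ`, then `‖entry‖ ≤ ‖(βL²)⁻¹‖²·(4·A·C·Λ)` — UNIFORM in the floor `ρmin` (= π/β): the model layer supplies only the annulus count of the
  fat/anisotropic sector (k3c2-p2 successor, BandSectorCounting currency) and the soft symbol's `A = 2βL²`-type constant.

Pure bookkeeping over the tree's closed form; nothing about the model is asserted; nothing asserts superconductivity.
-/

noncomputable section

namespace Summit.HubbardSuperconductivity.HubbardSuperconductivity.Theorems.TorusFourierL2

set_option linter.dupNamespace false -- summit = problem name (single-conjunct summit), D-0017

open Finset Literature.MathematicalPhysics.QuantumLattice Literature.Probability.LatticeModels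
open Summit.HubbardSuperconductivity.HubbardSuperconductivity.Theorems.KLRegimeSplit
open scoped ComplexConjugate

variable {L M N : ℕ} [NeZero L]

/-- **Entry bound by the SUM of the symbol over one sector's support**: for `‖F_ω‖ ≤ 1`,
`‖(S(F)ᵀ·normalCovariance p·S(F)) Y Y′‖ ≤ ‖(βL²)⁻¹‖²·Σ_{k : F_{ω_Y}(k) ≠ 0} ‖p(k, σ_Y)‖`. [cite: BenfattoGiulianiMastropietro2006, §2.7 (2.66)–(2.67)] -/
theorem norm_sectorSub_pullback_normalCovariance_le_of_sum [NeZero M] (β : ℝ) (F : Fin N → FreqMomentum L M → ℂ)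
    (hF : ∀ ω k, ‖F ω k‖ ≤ 1) (p : FreqMomentum L M × Fin 2 → ℂ) (Y Y' : SpaceTimeIdx L M × SectorLeg N) :
    ‖((sectorSubMatrix L M β F).transpose * normalCovariance L M p * sectorSubMatrix L M β F) Y Y'‖ ≤
      ‖((1 / (β * (L : ℝ) ^ 2) : ℝ) : ℂ)‖ ^ 2 *
        ∑ k ∈ (univ : Finset (FreqMomentum L M)).filter (fun k => F Y.2.1.1 k ≠ 0), ‖p (k, Y.2.1.2)‖ := by
  classical
  have hc0 : 0 ≤ ‖((1 / (β * (L : ℝ) ^ 2) : ℝ) : ℂ)‖ := norm_nonneg _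
  have hRHS : 0 ≤ ‖((1 / (β * (L : ℝ) ^ 2) : ℝ) : ℂ)‖ ^ 2 *
      ∑ k ∈ (univ : Finset (FreqMomentum L M)).filter (fun k => F Y.2.1.1 k ≠ 0), ‖p (k, Y.2.1.2)‖ :=
    mul_nonneg (pow_nonneg hc0 2) (sum_nonneg fun _ _ => norm_nonneg _)
  rw [sectorSub_pullback_normalCovariance_apply]
  by_cases hσ : Y.2.1.2 = Y'.2.1.2
  · rw [if_pos hσ]
    refine (norm_sum_le _ _).trans ?_
    have hw : ∀ (c : Fin 2) (k : FreqMomentum L M) (x : SpaceTimeIdx L M), ‖(starRingEnd ℂ) (hubbardPlaneWave L M β c k x)‖ = 1 :=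
      fun c k x => by rw [RCLike.norm_conj, norm_hubbardPlaneWave]
    -- termwise: `≤ ‖c‖²·‖p(k,σ)‖`, and `= 0` off the support of `F_ω`
    have hterm : ∀ k : FreqMomentum L M,
        ‖(((1 / (β * (L : ℝ) ^ 2) : ℝ) : ℂ) * (F Y.2.1.1 k * (starRingEnd ℂ) (hubbardPlaneWave L M β Y.2.2 k Y.1))) *
            (if Y.2.2 = 0 ∧ Y'.2.2 = 1 then p (k, Y.2.1.2) else if Y.2.2 = 1 ∧ Y'.2.2 = 0 then -p (k, Y.2.1.2) else 0) *
            (((1 / (β * (L : ℝ) ^ 2) : ℝ) : ℂ) * (F Y'.2.1.1 k * (starRingEnd ℂ) (hubbardPlaneWave L M β Y'.2.2 k Y'.1)))‖ ≤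
          ‖((1 / (β * (L : ℝ) ^ 2) : ℝ) : ℂ)‖ ^ 2 * (if F Y.2.1.1 k ≠ 0 then ‖p (k, Y.2.1.2)‖ else 0) := by
      intro k
      by_cases hk : F Y.2.1.1 k = 0
      · simp [hk]
      · rw [if_pos hk]
        have h1 := hF Y.2.1.1 k
        have h2 := hF Y'.2.1.1 k
        have hq : ‖(if Y.2.2 = 0 ∧ Y'.2.2 = 1 then p (k, Y.2.1.2) else if Y.2.2 = 1 ∧ Y'.2.2 = 0 then -p (k, Y.2.1.2) else 0)‖ ≤
            ‖p (k, Y.2.1.2)‖ := by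
          split_ifs
          · exact le_rfl
          · rw [norm_neg]
          · rw [norm_zero]; exact norm_nonneg _
        rw [norm_mul, norm_mul, norm_mul, norm_mul, norm_mul, norm_mul, hw, hw, mul_one, mul_one]
        have hp0 := norm_nonneg (p (k, Y.2.1.2))
        set q := (if Y.2.2 = 0 ∧ Y'.2.2 = 1 then p (k, Y.2.1.2) else if Y.2.2 = 1 ∧ Y'.2.2 = 0 then -p (k, Y.2.1.2) else 0) with hqdef
        have hq0 := norm_nonneg q
        calc ‖((1 / (β * (L : ℝ) ^ 2) : ℝ) : ℂ)‖ * ‖F Y.2.1.1 k‖ * ‖q‖ * (‖((1 / (β * (L : ℝ) ^ 2) : ℝ) : ℂ)‖ * ‖F Y'.2.1.1 k‖)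
            ≤ ‖((1 / (β * (L : ℝ) ^ 2) : ℝ) : ℂ)‖ * 1 * ‖p (k, Y.2.1.2)‖ * (‖((1 / (β * (L : ℝ) ^ 2) : ℝ) : ℂ)‖ * 1) := by gcongr
          _ = ‖((1 / (β * (L : ℝ) ^ 2) : ℝ) : ℂ)‖ ^ 2 * ‖p (k, Y.2.1.2)‖ := by ring
    refine (sum_le_sum fun k _ => hterm k).trans ?_
    rw [← mul_sum, Finset.sum_ite, sum_const_zero, add_zero]
  · rw [if_neg hσ, norm_zero]; exact hRHS

/-- **The dyadic form for a SOFT-shaped symbol**: with `‖F_ω‖ ≤ 1`, `‖p(k,σ_Y)‖ ≤ A/ρ k` and `ρmin ≤ ρ k ≤ Λ` on the support of `F_{ω_Y}`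
(`0 < ρmin`, `0 ≤ A`), and annulus counts `#{k : F_{ω_Y}(k) ≠ 0, r/2 < ρ k ≤ r} ≤ C·r²` for every `0 < r ≤ Λ`:
`‖(S(F)ᵀ·normalCovariance p·S(F)) Y Y′‖ ≤ ‖(βL²)⁻¹‖²·(4·A·C·Λ)` — β-uniform. -/
theorem norm_sectorSub_pullback_normalCovariance_le_of_dyadic [NeZero M] (β : ℝ) (F : Fin N → FreqMomentum L M → ℂ)
    (hF : ∀ ω k, ‖F ω k‖ ≤ 1) (p : FreqMomentum L M × Fin 2 → ℂ) (Y Y' : SpaceTimeIdx L M × SectorLeg N) (ρ : FreqMomentum L M → ℝ)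
    {Λ ρmin A C : ℝ} (hΛ : 0 < Λ) (hρmin : 0 < ρmin) (hA : 0 ≤ A) (hC : 0 ≤ C)
    (hp : ∀ k, F Y.2.1.1 k ≠ 0 → ‖p (k, Y.2.1.2)‖ ≤ A / ρ k)
    (hsupp : ∀ k, F Y.2.1.1 k ≠ 0 → ρmin ≤ ρ k ∧ ρ k ≤ Λ)
    (hcount : ∀ r : ℝ, 0 < r → r ≤ Λ →
      ((((univ : Finset (FreqMomentum L M)).filter (fun k => F Y.2.1.1 k ≠ 0)).filter fun k => r / 2 < ρ k ∧ ρ k ≤ r).card : ℝ) ≤ C * r ^ 2) :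
    ‖((sectorSubMatrix L M β F).transpose * normalCovariance L M p * sectorSubMatrix L M β F) Y Y'‖ ≤
      ‖((1 / (β * (L : ℝ) ^ 2) : ℝ) : ℂ)‖ ^ 2 * (4 * A * C * Λ) := by
  classical
  refine (norm_sectorSub_pullback_normalCovariance_le_of_sum β F hF p Y Y').trans (mul_le_mul_of_nonneg_left ?_ (pow_nonneg (norm_nonneg _) 2))
  set T := (univ : Finset (FreqMomentum L M)).filter (fun k => F Y.2.1.1 k ≠ 0) with hT
  have hmemT : ∀ k, k ∈ T ↔ F Y.2.1.1 k ≠ 0 := fun k => by rw [hT, mem_filter]; simp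
  -- `‖p‖ ≤ A/ρ` termwise, then the dyadic lemma with `f := A·𝟙` (masses = A × counts)
  have h1 : ∑ k ∈ T, ‖p (k, Y.2.1.2)‖ ≤ ∑ k ∈ T, A / ρ k := sum_le_sum fun k hk => hp k ((hmemT k).1 hk)
  refine h1.trans ?_
  have h2 : ∑ k ∈ T, A / ρ k = ∑ k ∈ T, (fun _ => A) k / ρ k := rfl
  rw [h2]
  have h3 := sum_div_radius_le_of_dyadic_mass' (s := T) (f := fun _ => A) (ρ := ρ) (Λ := Λ) (ρmin := ρmin) (C := A * C) hΛ hρmin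
    (mul_nonneg hA hC) (fun _ _ => hA) (fun k hk _ => hsupp k ((hmemT k).1 hk)) ?_
  · calc ∑ k ∈ T, (fun _ => A) k / ρ k ≤ 4 * (A * C) * Λ := h3
      _ = 4 * A * C * Λ := by ring
  · intro r hr hrΛ
    rw [sum_const, nsmul_eq_mul]
    have := hcount r hr hrΛ
    calc ((T.filter fun k => r / 2 < ρ k ∧ ρ k ≤ r).card : ℝ) * A ≤ C * r ^ 2 * A := mul_le_mul_of_nonneg_right this hA
      _ = A * C * r ^ 2 := by ring

end Summit.HubbardSuperconductivity.HubbardSuperconductivity.Theorems.TorusFourierL2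

end
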